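import Summits.QuantumFields.BalabanUV.Beta.FP.PerfectSymbol166

/-!
# `BalabanUV.Beta.FP.PerfectSymbol166Holo` — road «FP» (binder row D1), sub-row **W166-HOLO** (supplier of row H2-P-KER, the owner's
# H2-DESIGN §5 input (P-ii)), PART A: REGULARITY OF THE CLOSED-FORM CONTINUUM (1.66) MULTIPLIER — the alias factors `u_∞`, `U_∞`, the
# alias term `T_∞`, the `ℤ^d` series `R̃_∞`, and `Y_∞`, `F_∞`, `W_∞` are CONTINUOUS on the fat box and HOLOMORPHIC IN EVERY COORDINATE SLICE

HONEST FRAMING (cell contract, verbatim): «discharging `BetaPertH` makes Bałaban's UV stability UNCONDITIONAL — a real constructive-QFT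
result; it is NOT the continuum limit and NOT the Clay problem.»  HONEST DEPENDENCY (verbatim): «continuum YM on T⁴ ⇐ BetaPertH ∧ nine
spine estimates (0/9 proved); BetaPertH ⇐ (D1) ∧ (D4) ∧ CAP+tail; G-an2-4 gates asym, D1 and NE2/3/4.»  THIS MODULE DISCHARGES NOTHING of
D1 / BetaPertH: [folklore] one-variable complex analysis (removable singularity, holomorphy of locally uniformly convergent series) applied to
the road's OWN closed-form `k = ∞` objects of `FP/PerfectSymbolAlias` / `FP/PerfectSymbol166` (`uInf`, `UInf`, `SqInf`, `TInf`, `RtInf`,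
`cfacInf`, `D0Inf`, `YcInf`, `F66Inf`, `W166Inf`) over tree theorems BY NAME (`summable_maj`, `norm_T166_repK_le`, `tendsto_T166_repK`,
`SqInf_ne_zero`, `F66Inf_ne_zero`, `T4Rate166StripDirect.norm_two_sub_two_cos_sub_sq_le`).  No `def … : Prop`; nothing is cited; 0 sorry.
NOT summit progress; NOT BetaPertH, NOT continuum, NOT Clay.

ABSOLUTE RULE (cell, verbatim): «No internally-minted statement may enter as a cited fact. Every hypothesis is either kernel-proved in this
package or a verbatim quotation of a PUBLISHED theorem with page reference. The manuscript(s) under audit are NOT citable for their own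
disputed steps — they are the thing under adjudication; programme-internal (2001/route/tribunal) claims are never citable.»

WHY (`HOME/b2b-balaban-beta-d1-p3/H2-DESIGN.md` §5, row H2-P-KER of `LEAVES-FP.md`).  The unconstrained perfect propagator symbol
`PinfSym s ph = (feynMat (Re W_∞(s)) ph)⁻¹` (`FP/PerfectPropagatorSymbol`, p231001) carries the continuum (1.66) multiplier `W_∞ = W166Inf` as its
weight.  Every RATE statement for its x-space kernel (H2-DESIGN §5: «the `B` part needs … integrations by parts against the punctured
singularity»; input (P-ii): «analyticity of `A` on a strip (from `W166Inf`'s strip analyticity, tree)») needs REGULARITY of `W_∞` — and for the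
`k = ∞` closed form the tree so far has only POINTWISE/UNIFORM-LIMIT facts (`tendsto_W166`, `W166lim_rate`, `W166lim_eq_W166Inf`) and the finite-`n`
holomorphy `B5Symbol166Strip.differentiableAt_W166`.  This file supplies the regularity of the closed form itself, on the FAT BOX
`Fat d r = {|Re p_ν| ≤ π + r, |Im p_ν| ≤ 2r}` (`r ≤ 1/4`, `d·r² ≤ 1/16`), which is strictly larger than the zero-free strip and is the domain on which
the alias denominators are controlled (`SqInf_ne_zero`):
* §1 the one-coordinate weight `u_∞(l;·)`: holomorphic off its pole for `l ≠ 0`, ENTIRE for `l = 0` (removable singularity of `(2 − 2cos z)/z²` at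
  `0`, value `1`; `norm_uInf_zero_sub_one_le`: `‖u_∞(0;z) − 1‖ ≤ 2‖z‖²e^{‖z‖}`), continuous likewise;
* §2 the open fat box `FatO`, the one-variable boxes `boxC`/`boxO`, the open strip rectangle `rectO`, and `Function.update` bookkeeping;
* §3 joint CONTINUITY on `Fat` and coordinate-SLICE HOLOMORPHY (`z ↦ X (update p i z)`) of `UInf l`, `SqInf l` (`l ≠ 0`: non-vanishing), `TInf λ l`;
* §4 the `n`-free termwise bound `‖T_∞(λ;l;p)‖ ≤ (64·64/7)·maj l` on `Fat` (limit of `norm_T166_repK_le`) ⟹ `R̃_∞(λ;·)` continuous on `Fat`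
  (M-test, `continuousOn_tsum`) and slice-holomorphic on the open box (`Complex.differentiableOn_tsum_of_summable_norm`);
The assembly (`c_∞`, `Σp²`, `Y_∞`, `F_∞`, **`W_∞`** continuous on `Fat ∩ {F_∞ ≠ 0}` / slice-holomorphic on `FatO ∩ {F_∞ ≠ 0}`, and the strip corollaries)
is the sibling `FP/PerfectSymbol166HoloW`; parts B–D of the sub-row (strip regularity `StripRegular (W166Inf μ ν)`, `2π`-translation laws, the
real-line derivative package) import it.
Unit `b2b-balaban-beta-d1-formalise-leaf-01` (gen 8).
-/

noncomputable section

namespace Summit.QuantumFields.BalabanUV.Beta.FP.PerfectSymbol166Holo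

open Filter Topology Finset Complex
open scoped BigOperators
open Literature.MathematicalPhysics.QuantumFieldTheory.Balaban1983to89
open B4Strip (S1 Strip)
open B4StripCauchy (Fat strip_subset_fat rOf rOf_pos rOf_le d_mul_rOf_sq_le differentiable_S1 differentiable_update_apply)
open B5Symbol166Strip (kappa166 kappa166_le_rOf)
open T4Rate166StripDirect (norm_two_sub_two_cos_sub_sq_le fat_re fat_im)
open Summit.QuantumFields.BalabanUV.Beta.FP.PerfectSymbolAlias
open Summit.QuantumFields.BalabanUV.Beta.FP.PerfectSymbol166

variable {d : ℕ}

/-! ## §1 The one-coordinate weight `u_∞(l; z)`: removable singularity and holomorphy -/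

/-- [folklore] off the convention branch, `u_∞(l;z) = S₁(z)/(z + 2πl)²`. -/
theorem uInf_eq_of (l : ℤ) (z : ℂ) (h : ¬ (l = 0 ∧ z = 0)) : uInf l z = S1 z / (z + 2 * Real.pi * (l : ℂ)) ^ 2 := by
  unfold uInf; rw [if_neg h]

/-- [folklore] `u_∞(l;·)` for `l ≠ 0` is the rational-times-entire function `S₁(z)/(z + 2πl)²`. -/
theorem uInf_ne_eq {l : ℤ} (hl : l ≠ 0) : uInf l = fun z => S1 z / (z + 2 * Real.pi * (l : ℂ)) ^ 2 := by
  funext z; exact uInf_eq_of l z (fun h => hl h.1)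

/-- [folklore] `u_∞(0;z) = S₁(z)/z²` for `z ≠ 0`. -/
theorem uInf_zero_eq_of_ne {z : ℂ} (hz : z ≠ 0) : uInf 0 z = S1 z / z ^ 2 := by
  rw [uInf_eq_of 0 z (fun h => hz h.2)]; simp

/-- [folklore] `u_∞(0;0) = 1`. -/
theorem uInf_zero_zero : uInf 0 (0 : ℂ) = 1 := by unfold uInf; simp

/-- [folklore] **`‖u_∞(0;z) − 1‖ ≤ 2‖z‖²·e^{‖z‖}`** (fourth-order Taylor remainder of `2 − 2cos`, `T4Rate166StripDirect.norm_two_sub_two_cos_sub_sq_le`). -/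
theorem norm_uInf_zero_sub_one_le (z : ℂ) : ‖uInf 0 z - 1‖ ≤ 2 * ‖z‖ ^ 2 * Real.exp ‖z‖ := by
  by_cases hz : z = 0
  · subst hz; rw [uInf_zero_zero, sub_self, norm_zero]; positivity
  · have hz2 : z ^ 2 ≠ 0 := pow_ne_zero 2 hz
    rw [uInf_zero_eq_of_ne hz]
    have e : S1 z / z ^ 2 - 1 = (2 - 2 * Complex.cos z - z ^ 2) / z ^ 2 := by
      unfold S1; field_simp
    rw [e, norm_div, norm_pow, div_le_iff₀ (by positivity)]
    calc ‖2 - 2 * Complex.cos z - z ^ 2‖ ≤ 2 * ‖z‖ ^ 4 * Real.exp ‖z‖ := norm_two_sub_two_cos_sub_sq_le z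
      _ = 2 * ‖z‖ ^ 2 * Real.exp ‖z‖ * ‖z‖ ^ 2 := by ring

/-- [folklore] `u_∞(0;·)` is continuous at `0` (the removable singularity: `u_∞(0;z) → 1`). -/
theorem continuousAt_uInf_zero_zero : ContinuousAt (uInf 0) (0 : ℂ) := by
  rw [ContinuousAt, uInf_zero_zero, tendsto_iff_norm_sub_tendsto_zero]
  have h0 : Tendsto (fun z : ℂ => 2 * ‖z‖ ^ 2 * Real.exp ‖z‖) (𝓝 0) (𝓝 0) := by
    have hc : Continuous fun z : ℂ => 2 * ‖z‖ ^ 2 * Real.exp ‖z‖ := by fun_prop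
    simpa using hc.tendsto 0
  exact squeeze_zero (fun z => norm_nonneg _) norm_uInf_zero_sub_one_le h0

/-- [folklore] **`u_∞(0;·)` IS ENTIRE** (holomorphic off `0` as `S₁(z)/z²`, continuous at `0`:
`Complex.differentiableOn_compl_singleton_and_continuousAt_iff`). -/
theorem differentiable_uInf_zero : Differentiable ℂ (uInf 0) := by
  have hoff : DifferentiableOn ℂ (uInf 0) (Set.univ \ {0}) := by
    intro z hz
    have hz0 : z ≠ 0 := fun h => hz.2 h
    have hd : DifferentiableAt ℂ (fun w => S1 w / w ^ 2) z :=
      (differentiable_S1 z).div ((differentiable_id.pow 2) z) (pow_ne_zero 2 hz0)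
    have hev : uInf 0 =ᶠ[𝓝 z] fun w => S1 w / w ^ 2 :=
      Filter.eventuallyEq_of_mem (isOpen_ne.mem_nhds hz0) fun w hw => uInf_zero_eq_of_ne hw
    exact (hd.congr_of_eventuallyEq hev).differentiableWithinAt
  have h := (Complex.differentiableOn_compl_singleton_and_continuousAt_iff (f := uInf 0) (s := Set.univ) (c := 0)
    Filter.univ_mem).mp ⟨hoff, continuousAt_uInf_zero_zero⟩
  exact differentiableOn_univ.mp h

/-- [folklore] `u_∞(l;·)`, `l ≠ 0`, is holomorphic wherever `z + 2πl ≠ 0`. -/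
theorem differentiableAt_uInf_ne {l : ℤ} (hl : l ≠ 0) {z : ℂ} (hz : z + 2 * Real.pi * (l : ℂ) ≠ 0) :
    DifferentiableAt ℂ (uInf l) z := by
  rw [uInf_ne_eq hl]
  exact (differentiable_S1 z).div (((differentiable_id.add_const _).pow 2) z) (pow_ne_zero 2 hz)

/-- [folklore] **`u_∞(l;·)` is holomorphic at `z` whenever `z + 2πl ≠ 0` or `l = 0`** (the two cases together). -/
theorem differentiableAt_uInf {l : ℤ} {z : ℂ} (h : z + 2 * Real.pi * (l : ℂ) ≠ 0 ∨ l = 0) :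
    DifferentiableAt ℂ (uInf l) z := by
  by_cases hl : l = 0
  · subst hl; exact differentiable_uInf_zero z
  · exact differentiableAt_uInf_ne hl (h.resolve_right hl)

/-- [folklore] … hence continuous there. -/
theorem continuousAt_uInf {l : ℤ} {z : ℂ} (h : z + 2 * Real.pi * (l : ℂ) ≠ 0 ∨ l = 0) : ContinuousAt (uInf l) z :=
  (differentiableAt_uInf h).continuousAt

/-! ## §2 The fat box: open version, one-variable boxes, `update` bookkeeping -/

/-- [our object] the OPEN fat box `{|Re p_ν| < π + r, |Im p_ν| < 2r}` (interior of `B4StripCauchy.Fat d r`). -/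
def FatO (d : ℕ) (r : ℝ) : Set (Fin d → ℂ) := {q | ∀ ν, |(q ν).re| < Real.pi + r ∧ |(q ν).im| < 2 * r}

/-- [our object] the closed one-variable box `{|Re z| ≤ π + r, |Im z| ≤ 2r}`. -/
def boxC (r : ℝ) : Set ℂ := {z | |z.re| ≤ Real.pi + r ∧ |z.im| ≤ 2 * r}

/-- [our object] the open one-variable box `{|Re z| < π + r, |Im z| < 2r}`. -/
def boxO (r : ℝ) : Set ℂ := {z | |z.re| < Real.pi + r ∧ |z.im| < 2 * r}

/-- [folklore] `FatO ⊆ Fat`. -/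
theorem fatO_subset_fat (r : ℝ) : FatO d r ⊆ Fat d r := fun _ hq ν => ⟨(hq ν).1.le, (hq ν).2.le⟩

/-- [folklore] `boxO ⊆ boxC`. -/
theorem boxO_subset_boxC (r : ℝ) : boxO r ⊆ boxC r := fun _ hz => ⟨hz.1.le, hz.2.le⟩

/-- [folklore] the open one-variable box is open. -/
theorem isOpen_boxO (r : ℝ) : IsOpen (boxO r) :=
  (isOpen_lt (continuous_abs.comp Complex.continuous_re) continuous_const).inter
    (isOpen_lt (continuous_abs.comp Complex.continuous_im) continuous_const)

/-- [folklore] the open fat box is open. -/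
theorem isOpen_fatO (d : ℕ) (r : ℝ) : IsOpen (FatO d r) := by
  have e : FatO d r = ⋂ ν : Fin d, {q : Fin d → ℂ | |(q ν).re| < Real.pi + r} ∩ {q | |(q ν).im| < 2 * r} := by
    ext q; simp [FatO, Set.mem_iInter]
  rw [e]
  refine isOpen_iInter_of_finite fun ν => IsOpen.inter ?_ ?_
  · exact isOpen_lt (continuous_abs.comp (Complex.continuous_re.comp (continuous_apply ν))) continuous_const
  · exact isOpen_lt (continuous_abs.comp (Complex.continuous_im.comp (continuous_apply ν))) continuous_const

/-- [folklore] a coordinate of a fat point lies in the closed box. -/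
theorem apply_mem_boxC {r : ℝ} {p : Fin d → ℂ} (hp : p ∈ Fat d r) (ν : Fin d) : p ν ∈ boxC r := hp ν

/-- [folklore] a coordinate of an open-fat point lies in the open box. -/
theorem apply_mem_boxO {r : ℝ} {p : Fin d → ℂ} (hp : p ∈ FatO d r) (ν : Fin d) : p ν ∈ boxO r := hp ν

/-- [folklore] updating one coordinate of a fat point inside the closed box stays in the fat box. -/
theorem update_mem_fat {r : ℝ} {p : Fin d → ℂ} (hp : p ∈ Fat d r) (i : Fin d) {z : ℂ} (hz : z ∈ boxC r) :
    Function.update p i z ∈ Fat d r := by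
  intro ν
  by_cases h : ν = i
  · subst h; rw [Function.update_self]; exact hz
  · rw [Function.update_of_ne h]; exact hp ν

/-- [folklore] updating one coordinate of an open-fat point inside the open box stays in the open fat box. -/
theorem update_mem_fatO {r : ℝ} {p : Fin d → ℂ} (hp : p ∈ FatO d r) (i : Fin d) {z : ℂ} (hz : z ∈ boxO r) :
    Function.update p i z ∈ FatO d r := by
  intro ν
  by_cases h : ν = i
  · subst h; rw [Function.update_self]; exact hz
  · rw [Function.update_of_ne h]; exact hp ν

/-- [folklore] `update p i (p i) = p`. -/
theorem update_self_eq (p : Fin d → ℂ) (i : Fin d) : Function.update p i (p i) = p := Function.update_eq_self i p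

/-- [folklore] on the fat box (`r ≤ 1/4`) every alias denominator coordinate is off the pole of `u_∞`: `p_ν + 2πl ≠ 0 ∨ l = 0`. -/
theorem alias_ne_zero_or' {r : ℝ} (hr : r ≤ 1 / 4) {p : Fin d → ℂ} (hp : p ∈ Fat d r) (ν : Fin d) (l : ℤ) :
    p ν + 2 * Real.pi * (l : ℂ) ≠ 0 ∨ l = 0 := by
  rcases alias_ne_zero_or hr hp ν l with h | ⟨h, _⟩
  · exact Or.inl h
  · exact Or.inr h

/-- [folklore] the zero-free strip lies in the fat box of radius `rOf d` (`κ ≤ κ₁₆₆(d) ≤ rOf d`). -/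
theorem strip_subset_fat_rOf {κ : ℝ} (hκ : κ ≤ kappa166 d) : Strip d κ ⊆ Fat d (rOf d) :=
  strip_subset_fat (rOf_pos d).le (hκ.trans (kappa166_le_rOf d))

/-- [our object] the open one-variable rectangle of the strip: `{|Re z| < π, |Im z| < κ}` (= `B4ContourShift.openRect κ` as a set of `ℂ`). -/
def rectO (κ : ℝ) : Set ℂ := {z | |z.re| < Real.pi ∧ |z.im| < κ}

/-- [folklore] the open strip rectangle lies in the open box of radius `rOf d` (`κ ≤ κ₁₆₆(d) ≤ rOf d`, `0 < rOf d`). -/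
theorem rectO_subset_boxO_rOf {κ : ℝ} (hκ : κ ≤ kappa166 d) : rectO κ ⊆ boxO (rOf d) := by
  intro z hz
  have h0 := rOf_pos d
  have hκr : κ ≤ rOf d := hκ.trans (kappa166_le_rOf d)
  exact ⟨by linarith [hz.1], by linarith [hz.2]⟩

/-- [folklore] updating one coordinate of a strip point inside the open rectangle stays in the strip. -/
theorem update_mem_strip {κ : ℝ} {p : Fin d → ℂ} (hp : p ∈ Strip d κ) (i : Fin d) {z : ℂ} (hz : z ∈ rectO κ) :
    Function.update p i z ∈ Strip d κ := by
  intro ν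
  by_cases h : ν = i
  · subst h; rw [Function.update_self]; exact ⟨hz.1.le, hz.2.le⟩
  · rw [Function.update_of_ne h]; exact hp ν


/-! ## §3 Continuity and slice holomorphy of `U_∞`, `SqInf`, `T_∞` -/

section Slices

variable {r : ℝ} (hr : r ≤ 1 / 4)
include hr

/-- [folklore] `U_∞(l;·)` is continuous at every point of the fat box. -/
theorem continuousAt_UInf {p : Fin d → ℂ} (hp : p ∈ Fat d r) (l : Fin d → ℤ) : ContinuousAt (UInf l) p := by
  unfold UInf
  refine tendsto_finsetProd _ fun ν _ => ?_
  exact ((continuousAt_uInf (alias_ne_zero_or' hr hp ν (l ν))).tendsto).comp ((continuous_apply ν).tendsto p)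

/-- [folklore] `U_∞(l;·)` is continuous on the fat box. -/
theorem continuousOn_UInf (l : Fin d → ℤ) : ContinuousOn (UInf l) (Fat d r) :=
  fun _ hp => (continuousAt_UInf hr hp l).continuousWithinAt

/-- [folklore] **slice holomorphy of `U_∞`**: `z ↦ U_∞(l; update p i z)` is holomorphic at `p i` for every fat point `p`. -/
theorem differentiableAt_UInf_slice {p : Fin d → ℂ} (hp : p ∈ Fat d r) (i : Fin d) (l : Fin d → ℤ) :
    DifferentiableAt ℂ (fun z : ℂ => UInf l (Function.update p i z)) (p i) := by
  unfold UInf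
  refine B5Strip145Analytic.dAt_finset_prod _ _ _ fun ν _ => ?_
  have hF : DifferentiableAt ℂ (uInf (l ν)) (Function.update p i (p i) ν) := by
    rw [update_self_eq]
    exact differentiableAt_uInf (alias_ne_zero_or' hr hp ν (l ν))
  exact hF.comp (p i) (differentiable_update_apply p i ν (p i))

omit hr in
/-- [folklore] `Σ_ν (p_ν + 2πl_ν)²` is continuous. -/
theorem continuous_SqInf (l : Fin d → ℤ) : Continuous (SqInf (d := d) l) := by
  unfold SqInf; fun_prop

omit hr in
/-- [folklore] slice holomorphy of `SqInf l` (a polynomial). -/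
theorem differentiableAt_SqInf_slice (p : Fin d → ℂ) (i : Fin d) (l : Fin d → ℤ) (z : ℂ) :
    DifferentiableAt ℂ (fun w : ℂ => SqInf l (Function.update p i w)) z := by
  unfold SqInf
  refine DifferentiableAt.fun_sum fun ν _ => ?_
  exact ((differentiable_update_apply p i ν).add_const _ |>.pow 2) z

/-- [folklore] `T_∞(λ;l;·)` (`l ≠ 0`) is continuous at every point of the fat box (`d·r² ≤ 1/16`: the denominator does not vanish). -/
theorem continuousAt_TInf (hdr : (d : ℝ) * r ^ 2 ≤ 1 / 16) {p : Fin d → ℂ} (hp : p ∈ Fat d r) (lam : Fin d)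
    {l : Fin d → ℤ} (hl : l ≠ 0) : ContinuousAt (TInf lam l) p := by
  unfold TInf
  refine ((continuousAt_UInf hr hp l).mul ?_).div (continuous_SqInf l).continuousAt (SqInf_ne_zero hr hp hdr hl)
  exact ContinuousAt.comp (f := fun q : Fin d → ℂ => q lam) (x := p)
    (continuousAt_uInf (alias_ne_zero_or' hr hp lam (l lam))) (continuous_apply lam).continuousAt

/-- [folklore] `T_∞(λ;l;·)` (`l ≠ 0`) is continuous on the fat box. -/
theorem continuousOn_TInf (hdr : (d : ℝ) * r ^ 2 ≤ 1 / 16) (lam : Fin d) {l : Fin d → ℤ} (hl : l ≠ 0) :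
    ContinuousOn (TInf lam l) (Fat d r) :=
  fun _ hp => (continuousAt_TInf hr hdr hp lam hl).continuousWithinAt

/-- [folklore] **slice holomorphy of `T_∞`** (`l ≠ 0`) at `p i`, `p` in the fat box. -/
theorem differentiableAt_TInf_slice (hdr : (d : ℝ) * r ^ 2 ≤ 1 / 16) {p : Fin d → ℂ} (hp : p ∈ Fat d r) (i lam : Fin d)
    {l : Fin d → ℤ} (hl : l ≠ 0) : DifferentiableAt ℂ (fun z : ℂ => TInf lam l (Function.update p i z)) (p i) := by
  unfold TInf
  refine B5Strip145Analytic.dAt_div ((differentiableAt_UInf_slice hr hp i l).mul ?_)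
    (differentiableAt_SqInf_slice p i l (p i)) (by rw [update_self_eq]; exact SqInf_ne_zero hr hp hdr hl)
  have hF : DifferentiableAt ℂ (uInf (l lam)) (Function.update p i (p i) lam) := by
    rw [update_self_eq]
    exact differentiableAt_uInf (alias_ne_zero_or' hr hp lam (l lam))
  exact hF.comp (p i) (differentiable_update_apply p i lam (p i))

/-- [folklore] slice holomorphy of `T_∞` on the whole open box, for a fat base point. -/
theorem differentiableOn_TInf_slice (hdr : (d : ℝ) * r ^ 2 ≤ 1 / 16) {p : Fin d → ℂ} (hp : p ∈ Fat d r) (i lam : Fin d)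
    {l : Fin d → ℤ} (hl : l ≠ 0) : DifferentiableOn ℂ (fun z : ℂ => TInf lam l (Function.update p i z)) (boxO r) := by
  intro z hz
  have hp' : Function.update p i z ∈ Fat d r := update_mem_fat hp i (boxO_subset_boxC r hz)
  have h := differentiableAt_TInf_slice hr hdr hp' i lam hl
  simp only [Function.update_idem, Function.update_self] at h
  exact h.differentiableWithinAt

/-! ## §4 The `n`-free termwise bound and the series `R̃_∞` -/

/-- [folklore] **`‖T_∞(λ;l;p)‖ ≤ (64·64/7)·maj l`** on the fat box (`l ≠ 0`): the `n`-free domination `norm_T166_repK_le` passed to the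
termwise limit `tendsto_T166_repK`. -/
theorem norm_TInf_le (hdr : (d : ℝ) * r ^ 2 ≤ 1 / 16) {p : Fin d → ℂ} (hp : p ∈ Fat d r) (lam : Fin d) {l : Fin d → ℤ}
    (hl : l ≠ 0) : ‖TInf lam l p‖ ≤ 64 * (64 / 7) * maj l := by
  have ht := (tendsto_T166_repK hr hp hdr lam hl).norm
  refine le_of_tendsto ht ?_
  filter_upwards [eventually_mem_boxK l] with j hj
  exact norm_T166_repK_le hr hdr hp (j + 1) lam hj hl

/-- [our object] the summable majorant of the alias series (zero at `l = 0`). -/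
def majR (l : Fin d → ℤ) : ℝ := if l = 0 then 0 else 64 * (64 / 7) * maj l

omit hr in
/-- [folklore] the majorant is summable (`summable_maj`). -/
theorem summable_majR : Summable (majR (d := d)) := by
  have hs := (summable_maj (d := d)).mul_left (64 * (64 / 7))
  refine hs.of_nonneg_of_le (fun l => ?_) (fun l => ?_)
  · unfold majR; split_ifs
    · exact le_rfl
    · have := maj_nonneg l; positivity
  · unfold majR; split_ifs
    · have := maj_nonneg l; positivity
    · exact le_rfl

/-- [folklore] the alias summand (with the `l = 0` hole) is dominated by the majorant on the fat box. -/
theorem norm_term_le_majR (hdr : (d : ℝ) * r ^ 2 ≤ 1 / 16) {p : Fin d → ℂ} (hp : p ∈ Fat d r) (lam : Fin d) (l : Fin d → ℤ) :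
    ‖(if l = 0 then (0 : ℂ) else TInf lam l p)‖ ≤ majR l := by
  unfold majR
  by_cases h0 : l = 0
  · simp [h0]
  · rw [if_neg h0, if_neg h0]; exact norm_TInf_le hr hdr hp lam h0

/-- [folklore] **`R̃_∞(λ;·)` IS CONTINUOUS ON THE FAT BOX** (Weierstrass M-test: `continuousOn_tsum` with the majorant `majR`). -/
theorem continuousOn_RtInf (hdr : (d : ℝ) * r ^ 2 ≤ 1 / 16) (lam : Fin d) : ContinuousOn (RtInf (d := d) lam) (Fat d r) := by
  have h : ContinuousOn (fun p : Fin d → ℂ => ∑' l : Fin d → ℤ, (if l = 0 then (0 : ℂ) else TInf lam l p)) (Fat d r) := by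
    refine continuousOn_tsum (fun l => ?_) summable_majR (fun l p hp => norm_term_le_majR hr hdr hp lam l)
    by_cases h0 : l = 0
    · simp only [h0, if_true]; exact continuousOn_const
    · simp only [h0, if_false]; exact continuousOn_TInf hr hdr lam h0
  exact h.congr fun p _ => by unfold RtInf; rfl

/-- [folklore] **SLICE HOLOMORPHY OF `R̃_∞`**: for a fat base point `p`, `z ↦ R̃_∞(λ; update p i z)` is holomorphic on the open box
(`Complex.differentiableOn_tsum_of_summable_norm` with the majorant `majR`). -/
theorem differentiableOn_RtInf_slice (hdr : (d : ℝ) * r ^ 2 ≤ 1 / 16) {p : Fin d → ℂ} (hp : p ∈ Fat d r) (i lam : Fin d) :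
    DifferentiableOn ℂ (fun z : ℂ => RtInf lam (Function.update p i z)) (boxO r) := by
  have h : DifferentiableOn ℂ
      (fun z : ℂ => ∑' l : Fin d → ℤ, (if l = 0 then (0 : ℂ) else TInf lam l (Function.update p i z))) (boxO r) := by
    refine Complex.differentiableOn_tsum_of_summable_norm summable_majR (fun l => ?_) (isOpen_boxO r)
      (fun l z hz => norm_term_le_majR hr hdr (update_mem_fat hp i (boxO_subset_boxC r hz)) lam l)
    by_cases h0 : l = 0
    · simp only [h0, if_true]; exact differentiableOn_const _
    · simp only [h0, if_false]; exact differentiableOn_TInf_slice hr hdr hp i lam h0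
  exact h.congr fun z _ => by unfold RtInf; rfl

/-- [folklore] slice holomorphy of `R̃_∞` AT `p i`, for a fat base point whose `i`-th coordinate is in the OPEN box. -/
theorem differentiableAt_RtInf_slice (hdr : (d : ℝ) * r ^ 2 ≤ 1 / 16) {p : Fin d → ℂ} (hp : p ∈ Fat d r) {i : Fin d}
    (hi : p i ∈ boxO r) (lam : Fin d) : DifferentiableAt ℂ (fun z : ℂ => RtInf lam (Function.update p i z)) (p i) :=
  (differentiableOn_RtInf_slice hr hdr hp i lam).differentiableAt ((isOpen_boxO r).mem_nhds hi)

end Slices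

end Summit.QuantumFields.BalabanUV.Beta.FP.PerfectSymbol166Holo

end
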